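import Summits.BirchSwinnertonDyer.BirchSwinnertonDyer.Theses.ByReductionTypeAtTwo
import Summits.BirchSwinnertonDyer.Rank1Residual.Supersingular.SignedRankZero
import Summits.BirchSwinnertonDyer.Rank1Residual.P2.EmptyCellsAtTwo
import Literature.NumberTheory.EllipticCurves.SupersingularTwoSelmerTrivial
import HarnessLib

/-!
# Route `ByReductionTypeAtTwo` (rung K4), crux `SupersingularRankZeroAtTwo` (item
# stmt-BirchSwinnertonDyer-19097): the ONE printed class-level theorem at a supersingular `2` —
# Kurihara–Otsuki 2006, Thm. 0.1 (tree named fact) — read as `BSD(E,2)` on its locus (seat `bsd-2adic-ss-1`)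

HONEST FRAMING (cell `bsd-2adic`, run/shared/lean/pub/bsd-2adic/, HUMAN RULINGS D-0036/D-0059/D-0074):
THEOREMS ONLY, composing the tree's named fact `kuriharaOtsuki_selmer_trivial_supersingular_two`
(`Literature/NumberTheory/EllipticCurves/SupersingularTwoSelmerTrivial.lean`, a PUBLISHED theorem,
statement only, taken as the hypothesis `hKO` — D-0014) with the tree's rank-`0` bookkeeping.
PARTITION (D-0054): X5@2 good-ss (B1·O1; 763 book230 classes) × p = 2 — closes NONE of the 757
rank-`0` residue classes (all have `2⁴ ∣ #Ш_an`, while the Kurihara–Otsuki locus has `Ш[2] = 0`);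
it discharges IN PRINT the typed residue `MissingPPartAt W 2` of the sibling bridge
`supersingularRankZeroAtTwo_of_kobayashiMainConjecture_two_of_missingPPartAt` on the sub-locus
`{a₂ = ±2, ord₂(L(E,1)/Ω_E) = 0, ord₂ Tam(E) = 0}` of the crux's class (e.g. `X₀(11)` at `2`).

SOURCE, read at the page [corpus: paper:doi-10-4310-pamq-2006-v2-n2-a8 p0002]: M. Kurihara, R. Otsuki,
*On the growth of Selmer groups of an elliptic curve with supersingular reduction in the
`ℤ₂`-extension of `ℚ`*, Pure Appl. Math. Q. 2 (2006) 557–568. "**Theorem 0.1.** Let `E` be an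
elliptic curve defined over `ℚ` with supersingular reduction at `2`, and `L(E, s)` be the
`L`-function of `E`. We assume that `a₂ ≠ 0`, namely `a₂ = ±2`, and `ord₂(L(E,1)/Ω_E) =
ord₂(Tam(E)) = 0` where `ord₂ : ℚ^× → ℤ` is the normalized additive valuation at `2`. Then, …
(2) … Then, we have `Sel(E/ℚ) = 0`, `Sel(E/ℚ_n) ≃ ℚ₂/ℤ₂` for `n = 1, 2` as an abelian group, and …
(3) `Sel(E/ℚ_∞)^∨ ≃ ℤ₂[[Gal(ℚ_∞/ℚ)]]`." Conventions (p0001, p0005, p0007): "supersingular reduction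
at `2`" = good supersingular; `Tam(E) = ∏ c_ℓ`; `Ω_E` "the Néron period … `Ω_E = 2 min{Re ω > 0 |
ω ∈ Λ_E}` … we consider only real periods" = `∫_{E(ℝ)}|ω|` = the tree's `realPeriodRat` of a globally
minimal model; `Sel(E/F)` = the Selmer group of `E[2^∞]` over `F` with the Kummer conditions at all
places (§2.1) = the tree's `selmerGroupPInfty 2` at `F = ℚ`. Proof in the source: Kato's zeta
elements at `p = 2` over the cyclotomic `ℤ₂`-extension ("the proofs of Theorem 12.4 (3) and
Theorem 12.5 (4) can be applied to our case even for `p = 2`", p0008) + the Euler-system argument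
`Sel₀(E/ℚ) = 0` + Lemma 2.1.

The named fact transcribes clause (2)'s `Sel(E/ℚ) = 0` only (`Finite ∧ Nat.card = 1`), under
`a₂ = ±2`, `L(E,1)/Ω_E = t ∈ ℚ^×` with `ord₂ t = 0`, and `2 ∤ Tam(E)` (see its module docstring).
References: [KuriharaOtsuki2006] Thm. 0.1, §1.2, §2.1; [Kato2004Asterisque] Thm. 12.4,
12.5; [Miller2011LMS] Def. 1.1.
-/

set_option autoImplicit false
-- the Theorems namespace of this sub repeats the summit name by design (D-0017 nested layout)
set_option linter.dupNamespace false

noncomputable section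

open scoped Classical

open WeierstrassCurve Literature.NumberTheory.EllipticCurves
  Literature.NumberTheory.EllipticCurves.Rank1Residual Literature.NumberTheory.EllipticCurves.Rank1Residual.Typed
  Summit.BirchSwinnertonDyer.Rank1Residual Summit.BirchSwinnertonDyer.Rank1Residual.Supersingular

namespace Summit.BirchSwinnertonDyer.BirchSwinnertonDyer.Theorems

section Consequences

variable (W : WeierstrassCurve ℚ) [W.IsElliptic] [W.IsGloballyMinimal]

/-- **`BSD(E,2)` on the Kurihara–Otsuki locus, from PUBLISHED facts only.** For `E = W` globally
minimal with good supersingular reduction at `2`, `a₂ = ±2`, `L(E,1)/Ω_E = t ∈ ℚ^×` with `ord₂ t = 0`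
and `2 ∤ Tam(E)`: Kurihara–Otsuki Thm. 0.1 (2) (`hKO`: `Sel_{2^∞}(E/ℚ) = 0`) and Gross–Zagier–Kolyvagin
(`hGZK`: rank `0`, `Ш` finite, so `#Sel_{2^∞} = #Ш[2^∞]`) give `ord₂ #Ш = 0 = ord₂ t − ord₂ Tam =
ord₂ #Ш_an` (`E(ℚ)[2] = 0` at a supersingular `2`, `P2.irr_two_of_goodSS_two`), i.e. Miller's
`BSDp W 2`. Closes no residue class (`Ш[2] = 0` here); it is the printed corner of the crux's class.
[cite: KuriharaOtsuki2006, Thm. 0.1 (2) (p. 558)] [cite: Miller2011LMS, Def. 1.1] -/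
theorem missingPPartAt_two_of_kuriharaOtsuki (hKO : kuriharaOtsuki_selmer_trivial_supersingular_two)
    (hGZK : rank_eq_analyticRank_of_analyticRank_le_one)
    (hgood : W.HasGoodReductionAtPrime 2) (ha : W.frobeniusTrace 2 = 2 ∨ W.frobeniusTrace 2 = -2)
    {t : ℚ} (ht : W.entireLFunction 1 / (W.realPeriodRat : ℂ) = (t : ℂ)) (ht0 : t ≠ 0)
    (hvt : padicValRat 2 t = 0) (hTam : ¬ 2 ∣ W.tamagawaProduct) : MissingPPartAt W 2 := by
  have hss : (2 : ℤ) ∣ W.frobeniusTrace 2 := by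
    rcases ha with h | h <;> norm_num [h]
  have hirr : W.HasIrreducibleModPGaloisRep 2 := P2.irr_two_of_goodSS_two W ⟨hgood, hss⟩
  -- `L(E,1) ≠ 0`, analytic rank `0`
  have hΩC : (W.realPeriodRat : ℂ) ≠ 0 := Complex.ofReal_ne_zero.mpr W.realPeriodRat_pos_holds.ne'
  have hL : W.entireLFunction 1 ≠ 0 := by
    intro h0
    rw [h0, zero_div] at ht
    exact ht0 (by exact_mod_cast ht.symm)
  have hr : W.analyticRank = 0 := analyticRank_eq_zero_of_entireLFunction_one_ne_zero W hL
  -- GZK: rank `0`, `Ш` finite, `#Sel_{2^∞} = #Ш[2^∞]`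
  have hr0 : W.mordellWeilRank = 0 := (hGZK W (by omega)).1.trans hr
  haveI hfinE : Finite W.toAffine.Point := W.mordellWeilRank_eq_zero_iff_finite.mp hr0
  haveI hfinSha : Finite W.sha := (hGZK W (by omega)).2
  have hSel : Nat.card (W.selmerGroupPInfty 2) =
      Nat.card (AddCommGroup.primaryComponent W.sha 2) :=
    W.natCard_selmerGroupPInfty_eq_natCard_primaryComponent_sha 2
  -- Kurihara–Otsuki: `#Sel_{2^∞}(E/ℚ) = 1`
  obtain ⟨-, hcard⟩ := hKO W hgood ha ⟨t, ht, ht0, hvt⟩ hTam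
  have hsha : padicValNat 2 W.shaOrder = 0 := by
    rw [WeierstrassCurve.shaOrder, ← padicValNat_card_addPrimaryComponent (A := W.sha) 2, ← hSel,
      hcard, padicValNat_one_right]
  refine ⟨t * (W.torsionOrder : ℚ) ^ 2 / (W.tamagawaProduct : ℚ),
    shaAn_eq_of_analyticRank_eq_zero W hGZK hr ht, ?_⟩
  rw [padicValRat_shaAn_witness W 2 hirr ht0, hvt, hsha, padicValNat.eq_zero_of_not_dvd hTam]
  simp

/-- **`BSD(E,2)` on the Kurihara–Otsuki locus** (`MissingPPartAt` + GZK ⇒ Miller's `BSDp W 2`, by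
`bsdp_of_missingPPartAt`). [cite: KuriharaOtsuki2006, Thm. 0.1 (2) (p. 558)] [cite: Miller2011LMS, Def. 1.1] -/
theorem bsdp_two_of_kuriharaOtsuki (hKO : kuriharaOtsuki_selmer_trivial_supersingular_two)
    (hGZK : rank_eq_analyticRank_of_analyticRank_le_one)
    (hgood : W.HasGoodReductionAtPrime 2) (ha : W.frobeniusTrace 2 = 2 ∨ W.frobeniusTrace 2 = -2)
    {t : ℚ} (ht : W.entireLFunction 1 / (W.realPeriodRat : ℂ) = (t : ℂ)) (ht0 : t ≠ 0)
    (hvt : padicValRat 2 t = 0) (hTam : ¬ 2 ∣ W.tamagawaProduct) : BSDp W 2 := by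
  have hΩC : (W.realPeriodRat : ℂ) ≠ 0 := Complex.ofReal_ne_zero.mpr W.realPeriodRat_pos_holds.ne'
  have hL : W.entireLFunction 1 ≠ 0 := by
    intro h0
    rw [h0, zero_div] at ht
    exact ht0 (by exact_mod_cast ht.symm)
  have hr : W.analyticRank = 0 := analyticRank_eq_zero_of_entireLFunction_one_ne_zero W hL
  exact bsdp_of_missingPPartAt W 2 hGZK (by omega)
    (missingPPartAt_two_of_kuriharaOtsuki W hKO hGZK hgood ha ht ht0 hvt hTam)

/-- **Class-level reading: the typed `a₂ = ±2` residue of the crux SHRINKS, in print, to the locus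
`2 ∣ (L(E,1)/Ω_E)·Tam(E)`** (which contains all 757 census residue classes). Granted Kurihara–Otsuki
(`hKO`, PUB), modularity (`hmod` for the rationality `L(E,1)/Ω_E ∈ ℚ` via the newform's period ratio,
`hmod'`) and GZK: if `MissingPPartAt W 2` is supplied on the non-CM, rank-`0`, good-supersingular-at-`2`
curves with `a₂ = ±2` AND (`2 ∣ Tam(E)` or `ord₂(L(E,1)/Ω_E) ≠ 0`), then it holds on ALL such curves
with `a₂ = ±2`. Composition certificate; nothing asserted.
[cite: KuriharaOtsuki2006, Thm. 0.1 (2) (p. 558)] [cite: Miller2011LMS, Def. 1.1] -/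
theorem missingPPartAt_two_traceTwo_of_kuriharaOtsuki_of_residue
    (hKO : kuriharaOtsuki_selmer_trivial_supersingular_two)
    (hGZK : rank_eq_analyticRank_of_analyticRank_le_one)
    (hgood : W.HasGoodReductionAtPrime 2) (ha : W.frobeniusTrace 2 = 2 ∨ W.frobeniusTrace 2 = -2)
    {t : ℚ} (ht : W.entireLFunction 1 / (W.realPeriodRat : ℂ) = (t : ℂ)) (ht0 : t ≠ 0)
    (hres : (2 ∣ W.tamagawaProduct ∨ padicValRat 2 t ≠ 0) → MissingPPartAt W 2) :
    MissingPPartAt W 2 := by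
  by_cases hTam : 2 ∣ W.tamagawaProduct
  · exact hres (Or.inl hTam)
  by_cases hvt : padicValRat 2 t = 0
  · exact missingPPartAt_two_of_kuriharaOtsuki W hKO hGZK hgood ha ht ht0 hvt hTam
  · exact hres (Or.inr hvt)

end Consequences

end Summit.BirchSwinnertonDyer.BirchSwinnertonDyer.Theorems

end
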